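import Literature.NumberTheory.Automorphic.Liu2021.NablaGaloisDescent
import Literature.AlgebraicGeometry.Motives.AbelianVarietyComplexPoints
import Literature.AlgebraicGeometry.HodgeTheory.BettiUniverseAxioms
import HarnessLib

/-!
# Liu 2021 Lemma 2.4 (1): `(α_X)_x^* : H¹_{B,τ}(Alb_X, ℚ) ≃ H¹_{B,τ}(X, ℚ)` (named fact)

Topic `Literature/NumberTheory/Automorphic/Liu2021` (companion of `Liu2021/AlbaneseBaseChangeFact`, same object:
the structure `AppendixC.Albanese X` of `Liu2021/AppendixC/Glue.lean` = Liu's point-free Albanese datum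
`α_X : ∇X → Alb_X`, Def. 2.3).  ONE named fact (`def … : Prop`, D-0026 +1), nothing else; no instance, no `variable`.

[Liu2021] = Yifeng Liu, *Fourier–Jacobi cycles and arithmetic relative trace formula*, Camb. J. Math. **9** (2021)
= arXiv:2102.11518 (`FJcycle.tex` line numbers as in `AppendixC/Glue.lean`).

## What is printed (p. 23 L32–42 + p. 24 L5–6, l. 1210–1228)

«**Lemma 2.4.** Suppose that `k` has characteristic zero. Then (1) for every homomorphism `τ : k → ℂ`, we have a canonical
isomorphism `H¹_{B,τ}(Alb_X, ℚ) ≃ H¹_{B,τ}(X, ℚ); […]»  PROOF of (1): «we pick an element `x ∈ X(π₀(X ⊗_{k,τ} ℂ))`, which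
induces a morphism `(α_X)_x : X ⊗_{k,τ} ℂ → Alb_X ⊗_{k,τ} ℂ` from Definition 2.3 and Definition 2.1. By the property of complex
Albanese varieties, the induced map `(α_X)^*_x : H¹_{B,τ}(Alb, ℚ) → H¹_{B,τ}(X, ℚ)` is an isomorphism; it is independent of the
choice of `x` since translation acts trivially on `H¹_{B,τ}(Alb, ℚ)`.»  Standing hypothesis (Prop. 2.2, l. 1191; Def. 2.3,
l. 1203): «Let `X` be a proper smooth scheme in `Sch_{/k}`».

## Reading (token level)

* `k`, «characteristic zero» := `[Field k] [CharZero k]`; «homomorphism `τ : k → ℂ`» := an algebra structure `[Algebra k ℂ]`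
  (`τ = algebraMap k ℂ`); `− ⊗_{k,τ} ℂ` := `AbelianVariety.bcFunctor k ℂ` (Mathlib `Over.pullback`), and for the abelian variety
  `Alb_X ⊗_{k,τ} ℂ := a.Alb.baseChange ℂ` (whose underlying `ℂ`-scheme is `(bcFunctor k ℂ).obj a.Alb.X`).
* «proper smooth scheme `X`» := `IsProper X.hom`, `Smooth X.hom` (Mathlib), as in `albanese_baseChange`.
* `Alb_X`, `α_X` := ANY corepresenting datum `a : AppendixC.Albanese X` (Def. 2.3; unique up to a unique isomorphism,
  `AppendixC.Albanese.nonempty_iso`) — the lemma is about the functor it corepresents, so it holds for every datum.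
* «`x ∈ X(π₀(X ⊗_{k,τ} ℂ))`» (one complex point on each connected component) := a colimit cofan
  `inj q : Y q ⟶ X ⊗_k ℂ` (`IsColimit (Cofan.mk _ inj)`) of GEOMETRICALLY IRREDUCIBLE complex pieces `Y q` (for the smooth
  `X ⊗ ℂ`, connected components = irreducible components) together with points `x q : Spec ℂ ⟶ Y q`.
* «`(α_X)_x` from Definition 2.3 and Definition 2.1» := ANY morphism `αx : X ⊗_k ℂ ⟶ Alb_X ⊗_k ℂ` whose restriction to the
  piece `Y q` is `y ↦ α_X(y, x_q)`, i.e. `inj q ≫ αx = (𝟙, x_q) ≫ ℓ q ≫ (α_X)_ℂ` for a lift `ℓ q : Y q × Y q ⟶ (∇X)_ℂ` of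
  `inj q × inj q : Y q × Y q ⟶ (X × X)_ℂ` through the immersion `(∇X ↪ X × X)_ℂ` (Def. 2.1 (1): `∇X` := «the smallest open and
  closed subscheme of `X × X` containing the diagonal `ΔX`»; over `ℂ`, which splits `X` (Def. 2.1 (2)), it is the union of the
  `X_i × X_i` over the connected components `X_i` of `X ⊗_{k,τ} ℂ`; the lift exists because `Y q × Y q` is irreducible and meets
  the clopen `(∇X)_ℂ` along the diagonal, and is unique because `∇X ↪ X × X` is a monomorphism — so quantifying over all lifts
  `ℓ` types exactly Liu's `(α_X)_x` = the `f_x` of Def. 2.1 (3) for `f = α_X`).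
* `H¹_{B,τ}(−, ℚ)` := `Motives.bettiCohomology − 1` of the complexified scheme; `(·)^*` := `HodgeTheory.BettiUniverse.pull · 1`;
  «is an isomorphism» (of `ℚ`-vector spaces) := `Function.Bijective`.

STATUS: a cited, proved lemma of [Liu2021] (its proof uses, silently, that `Alb_X ⊗_{k,τ} ℂ` is the complex Albanese variety of
`X ⊗_{k,τ} ℂ` — Grothendieck FGA VI Thm. 3.3 (iii), cf. `albanese_baseChange` — and `Alb(∐ P) = ∏ Alb(P)`, `H¹` additive).
NOT part of this fact: part (2) (étale `H¹`); the independence of `x`; any existence statement.  Nothing is asserted; a consumer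
takes `(h : albanese_bettiOne_pullback_bijective)`.

## References

* [Liu2021] Y. Liu, arXiv:2102.11518 = Camb. J. Math. 9 (2021): Lemma 2.4 (1) (p. 23 L32–36; l. 1210–1213) with proof
  (p. 23 L37–42 + p. 24 L5–6; l. 1220–1228); Def. 2.1 (1)–(3) (p. 22 L18–32; l. 1171–1184), Prop. 2.2 (p. 23 L5–8; l. 1190–1192),
  Def. 2.3 (p. 23 L25–31; l. 1202–1208).
* [Grothendieck1962FGA6] A. Grothendieck, FGA VI (Sém. Bourbaki 236), Thm. 3.3 (iii) (provenance of the silent step only).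
-/

noncomputable section

open CategoryTheory CategoryTheory.Limits AlgebraicGeometry MonoidalCategory CartesianMonoidalCategory
open Literature.AlgebraicGeometry.Motives Literature.AlgebraicGeometry.HodgeTheory

namespace Literature.NumberTheory.Automorphic.Liu2021

open AbelianVariety (bcFunctor)

/-- **[Liu2021, Lemma 2.4 (1)]** — «Suppose that `k` has characteristic zero. Then for every homomorphism `τ : k → ℂ`, we
have a canonical isomorphism `H¹_{B,τ}(Alb_X, ℚ) ≃ H¹_{B,τ}(X, ℚ)`», the isomorphism being `(α_X)_x^*` for a choice
`x ∈ X(π₀(X ⊗_{k,τ} ℂ))` of one complex point on each connected component (proof, l. 1220–1228): for every proper smooth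
`X / k`, every Albanese datum `a` of `X` (Def. 2.3), every colimit cofan `inj q : Y q ⟶ X ⊗_k ℂ` of geometrically irreducible
complex pieces with points `x q`, every family of lifts `ℓ q : Y q × Y q ⟶ (∇X)_ℂ` of `inj q × inj q`, and every
`αx : X ⊗_k ℂ ⟶ Alb_X ⊗_k ℂ` restricting on each piece to `y ↦ α_X(ℓ q (y, x q))` (this is `(α_X)_x`), the pull-back
`αx^* : H¹((Alb_X ⊗_k ℂ)(ℂ); ℚ) → H¹((X ⊗_k ℂ)(ℂ); ℚ)` is a bijection.
[cite: Liu2021, Lemma 2.4 (1) (FJcycle.tex l. 1210–1213) with proof (l. 1220–1228); Def. 2.1 (1)–(3), Def. 2.3 (l. 1171–1184, 1202–1208)] -/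
def albanese_bettiOne_pullback_bijective : Prop :=
  ∀ (k : Type) [Field k] [CharZero k] [Algebra k ℂ] (X : SchemeOver k), IsProper X.hom → Smooth X.hom →
    ∀ (a : AppendixC.Albanese X) (Ξ : Type) (Y : Ξ → SchemeOver ℂ) [∀ q, GeometricallyIrreducible (Y q).hom]
      (inj : ∀ q, Y q ⟶ (bcFunctor k ℂ).obj X) (_ : IsColimit (Cofan.mk ((bcFunctor k ℂ).obj X) inj))
      (x : ∀ q, AlgPoints (Y q) ℂ) (ℓ : ∀ q, Y q ⊗ Y q ⟶ (bcFunctor k ℂ).obj a.nabla.N)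
      (_ : ∀ q, ℓ q ≫ (bcFunctor k ℂ).map a.nabla.incl = (inj q ⊗ₘ inj q) ≫ Functor.LaxMonoidal.μ (bcFunctor k ℂ) X X)
      (αx : (bcFunctor k ℂ).obj X ⟶ (a.Alb.baseChange ℂ).X)
      (_ : ∀ q, inj q ≫ αx = lift (𝟙 (Y q)) (toSpecOver (Y q) ≫ x q) ≫ ℓ q ≫ (bcFunctor k ℂ).map a.α),
      Function.Bijective (BettiUniverse.pull αx 1)

end Literature.NumberTheory.Automorphic.Liu2021

end
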